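import Mathlib.Algebra.BigOperators.Ring.Finset
import Mathlib.Algebra.Order.BigOperators.Group.Finset
import Mathlib.Data.Fintype.Powerset
import Literature.Computability.Complexity.AOWRefutation
import HarnessLib

/-!
# XOR biases of a `k`-SAT instance and the Fourier refutation criterion
(Allen–O'Donnell–Witmer 2015, §4)

Trunk T-CPLX-CORE (Literature/Computability/Complexity). Support file for the discharge of the
named fact `allen_odonnell_witmer_kSAT` (`AOWRefutation.lean`), deterministic part I.

For a multiset `L` of AOW constraints `(T, c)` (ordered scope `T ∈ [n]^k`, negation pattern `c`),
an assignment `x ∈ {0,1}^n` and a set of positions `S ⊆ [k]`, the **`S`-bias** is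
`bias_S(x) = ∑_{(T,c) ∈ L} ∏_{i ∈ S} z_i`, where `z_i = ±1` is the truth value of the `i`-th literal
(`+1` = true). These are (up to the factor `m`) the Fourier coefficients `D̂_{L,x}(S)` of the
induced distribution of Allen–O'Donnell–Witmer, Def. 3.2. The Fourier expansion of the indicator
"all `k` literals false", `∏_i (1 - z_i)/2 = 2^{-k} ∑_S (-1)^{|S|} z^S`, gives the exact identity

  `2^k · #{constraints of L falsified by x} = ∑_{S ⊆ [k]} (-1)^{|S|} bias_S(x)`

(`two_pow_mul_falsifiedCount_eq_sum_bias`), whence the **refutation criterion**: if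
`∑_{S ≠ ∅} |bias_S(x)| < |L|` for every `x`, then every assignment falsifies some constraint of `L`
(`exists_falsified_of_sum_abs_bias_lt`), so any CNF containing the clauses of `L` is
unsatisfiable (`not_satisfiable_of_sum_abs_bias_lt`). This is the `P = OR_k` instance of AOW's
"Proof 2" of Thm. 4.9 (strong refutation from small Fourier coefficients, via Plancherel), in the
weak-refutation form needed for `allen_odonnell_witmer_kSAT`; certifying that each `|bias_S(x)|`
is small is the job of the spectral certificates (`AOWTraceCertificate.lean`,
`AOWLevelCertificates.lean`).

## References

* S. R. Allen, R. O'Donnell, D. Witmer, *How to refute a random CSP*, FOCS 2015,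
  arXiv:1505.04383: Def. 3.2 (induced distribution `D_{I,x}`), §4.1 (Fourier expansion of
  `k`-XOR, proof of Cor. 4.2), §4.3 "Proof 2" of Thm. 4.9 (refutation from small Fourier
  coefficients).
* R. O'Donnell, *Analysis of Boolean Functions*, CUP 2014, §1.2 (Fourier expansion of AND/OR).
-/

namespace Literature.Computability.Complexity

open Finset

/-! ### `±1` values -/

/-- The `±1` encoding of a Boolean (`true ↦ 1`, `false ↦ -1`). [O'Donnell 2014, §1.1] [folklore] -/
def pmSign (b : Bool) : ℤ := if b then 1 else -1

/-- `pmSign true = 1`. [folklore] -/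
@[simp] theorem pmSign_true : pmSign true = 1 := rfl

/-- `pmSign false = -1`. [folklore] -/
@[simp] theorem pmSign_false : pmSign false = -1 := rfl

/-- `pmSign b * pmSign b = 1`. [folklore] -/
@[simp] theorem pmSign_mul_self (b : Bool) : pmSign b * pmSign b = 1 := by
  cases b <;> simp

/-- `pmSign b ^ 2 = 1`. [folklore] -/
@[simp] theorem pmSign_sq (b : Bool) : pmSign b ^ 2 = 1 := by
  rw [sq, pmSign_mul_self]

/-- `|pmSign b| = 1`. [folklore] -/
@[simp] theorem abs_pmSign (b : Bool) : |pmSign b| = 1 := by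
  cases b <;> simp

/-- `pmSign a * pmSign b = pmSign (a == b)`: the product of signs is the sign of "equal".
[folklore] -/
theorem pmSign_mul_pmSign (a b : Bool) : pmSign a * pmSign b = pmSign (a == b) := by
  cases a <;> cases b <;> simp

/-- A product of `±1` values is `±1`; in particular its square is `1`. [folklore] -/
theorem prod_pmSign_sq {α : Type} (s : Finset α) (f : α → Bool) :
    (∏ a ∈ s, pmSign (f a)) ^ 2 = 1 := by
  rw [← Finset.prod_pow]
  simp

namespace AOWConstraint

variable {k n : ℕ}

/-- The `±1` truth value of the `i`-th literal `(T i, c i)` of the constraint `C = (T, c)` under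
the assignment `x`: `+1` iff `x (T i) = c i` (the literal is true, cf. `Literal.eval`).
[Allen–O'Donnell–Witmer 2015, Def. 3.2 (`c ∘ x_S`)] [cite: arXiv150504383, Def. 3.2] -/
def litSign (C : AOWConstraint k n) (x : Fin n → Bool) (i : Fin k) : ℤ :=
  pmSign (x (C.1 i)) * pmSign (C.2 i)

/-- `C` is falsified by `x`: all its literals are false. [Allen–O'Donnell–Witmer 2015, §4.1
(`P = OR_k`)] [folklore] -/
def IsFalsifiedBy (C : AOWConstraint k n) (x : Fin n → Bool) : Prop :=
  ∀ i : Fin k, x (C.1 i) ≠ C.2 i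

/-- `IsFalsifiedBy` is decidable (a finite conjunction of Boolean disequalities). [folklore] -/
instance instDecidableIsFalsifiedBy (C : AOWConstraint k n) (x : Fin n → Bool) :
    Decidable (C.IsFalsifiedBy x) :=
  inferInstanceAs (Decidable (∀ i : Fin k, x (C.1 i) ≠ C.2 i))

/-- `litSign = pmSign (x (T i) == c i)`. [folklore] -/
theorem litSign_eq (C : AOWConstraint k n) (x : Fin n → Bool) (i : Fin k) :
    C.litSign x i = pmSign (x (C.1 i) == C.2 i) :=
  pmSign_mul_pmSign _ _

/-- A false literal has value `-1`. [folklore] -/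
theorem litSign_of_ne {C : AOWConstraint k n} {x : Fin n → Bool} {i : Fin k}
    (h : x (C.1 i) ≠ C.2 i) : C.litSign x i = -1 := by
  unfold litSign
  revert h
  cases x (C.1 i) <;> cases C.2 i <;> simp

/-- A true literal has value `1`. [folklore] -/
theorem litSign_of_eq {C : AOWConstraint k n} {x : Fin n → Bool} {i : Fin k}
    (h : x (C.1 i) = C.2 i) : C.litSign x i = 1 := by
  rw [litSign_eq, h]
  simp

/-- **Fourier expansion of the falsification indicator**: `∏_i (1 - z_i) = 2^k` if `C` is
falsified by `x` and `0` otherwise. [O'Donnell 2014, §1.2; Allen–O'Donnell–Witmer 2015, §4.1] [folklore] -/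
theorem prod_one_sub_litSign (C : AOWConstraint k n) (x : Fin n → Bool) :
    ∏ i, (1 - C.litSign x i) = if C.IsFalsifiedBy x then (2 : ℤ) ^ k else 0 := by
  split_ifs with h
  · have h2 : ∀ i, 1 - C.litSign x i = 2 := fun i => by rw [litSign_of_ne (h i)]; norm_num
    simp [h2, Finset.prod_const, Finset.card_univ]
  · simp only [IsFalsifiedBy, not_forall, not_not] at h
    obtain ⟨i, hi⟩ := h
    exact Finset.prod_eq_zero (Finset.mem_univ i) (by rw [litSign_of_eq hi]; norm_num)

end AOWConstraint

/-- The inclusion–exclusion / Fourier identity `∏_i (1 - z_i) = ∑_S (-1)^{|S|} ∏_{i∈S} z_i` over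
`Fin k`. [O'Donnell 2014, §1.2] [folklore] -/
theorem prod_one_sub_eq_sum_powerset {k : ℕ} (z : Fin k → ℤ) :
    ∏ i, (1 - z i) = ∑ S : Finset (Fin k), (-1) ^ S.card * ∏ i ∈ S, z i := by
  have h := Finset.prod_add (fun i => -z i) (fun _ => (1 : ℤ)) Finset.univ
  simp only [Finset.prod_const_one, mul_one, Finset.powerset_univ] at h
  calc ∏ i, (1 - z i) = ∏ i, (-z i + 1) := Finset.prod_congr rfl fun i _ => by ring
    _ = ∑ t : Finset (Fin k), ∏ i ∈ t, -z i := h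
    _ = ∑ S : Finset (Fin k), (-1) ^ S.card * ∏ i ∈ S, z i :=
        Finset.sum_congr rfl fun S _ => Finset.prod_neg _

/-! ### Biases -/

variable {k n : ℕ}

/-- The **`S`-bias** of the constraint multiset `L` at the assignment `x`:
`bias_S(x) = ∑_{C ∈ L} ∏_{i ∈ S} z_i(C, x)` — `m` times the Fourier coefficient `D̂_{L,x}(S)` of
the induced distribution. [Allen–O'Donnell–Witmer 2015, Def. 3.2 and eq. (4) in the proof of
Lemma 4.3] [cite: arXiv150504383, Def. 3.2] -/
def bias (L : List (AOWConstraint k n)) (S : Finset (Fin k)) (x : Fin n → Bool) : ℤ :=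
  (L.map fun C => ∏ i ∈ S, C.litSign x i).sum

/-- `bias [] S x = 0`. [folklore] -/
@[simp] theorem bias_nil (S : Finset (Fin k)) (x : Fin n → Bool) :
    bias ([] : List (AOWConstraint k n)) S x = 0 := rfl

/-- `bias (C :: L) S x = ∏_{i∈S} z_i(C,x) + bias L S x`. [folklore] -/
@[simp] theorem bias_cons (C : AOWConstraint k n) (L : List (AOWConstraint k n)) (S : Finset (Fin k))
    (x : Fin n → Bool) : bias (C :: L) S x = (∏ i ∈ S, C.litSign x i) + bias L S x := by
  simp [bias]

/-- The empty bias counts the constraints: `bias_∅(x) = |L|`. [Allen–O'Donnell–Witmer 2015, §4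
(`D̂(∅) = 1`)] [folklore] -/
@[simp] theorem bias_empty (L : List (AOWConstraint k n)) (x : Fin n → Bool) :
    bias L ∅ x = L.length := by
  induction L with
  | nil => rfl
  | cons C L ih => simp [ih]; ring

/-- `|bias_S(x)| ≤ |L|` (each term is `±1`). [folklore] -/
theorem abs_bias_le_length (L : List (AOWConstraint k n)) (S : Finset (Fin k)) (x : Fin n → Bool) :
    |bias L S x| ≤ L.length := by
  induction L with
  | nil => simp
  | cons C L ih =>
    rw [bias_cons, List.length_cons, Nat.cast_succ]
    refine (abs_add_le _ _).trans ?_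
    have h1 : |∏ i ∈ S, C.litSign x i| = 1 := by
      rw [Finset.abs_prod]
      exact Finset.prod_eq_one fun i _ => by simp [AOWConstraint.litSign, abs_mul]
    rw [h1]
    linarith

/-- The number of constraints of `L` falsified by `x`. [folklore] -/
def falsifiedCount (L : List (AOWConstraint k n)) (x : Fin n → Bool) : ℕ :=
  L.countP fun C => decide (C.IsFalsifiedBy x)

/-- `falsifiedCount [] x = 0`. [folklore] -/
@[simp] theorem falsifiedCount_nil (x : Fin n → Bool) :
    falsifiedCount ([] : List (AOWConstraint k n)) x = 0 := rfl

/-- Unfolding `falsifiedCount` on a cons. [folklore] -/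
theorem falsifiedCount_cons (C : AOWConstraint k n) (L : List (AOWConstraint k n))
    (x : Fin n → Bool) :
    falsifiedCount (C :: L) x = falsifiedCount L x + if C.IsFalsifiedBy x then 1 else 0 := by
  simp [falsifiedCount, List.countP_cons]

/-- No constraint of `L` is falsified iff `falsifiedCount L x = 0`. [folklore] -/
theorem falsifiedCount_eq_zero_iff (L : List (AOWConstraint k n)) (x : Fin n → Bool) :
    falsifiedCount L x = 0 ↔ ∀ C ∈ L, ¬ C.IsFalsifiedBy x := by
  simp [falsifiedCount, List.countP_eq_zero]

/-- **The Fourier identity** `2^k · #falsified(x) = ∑_{S ⊆ [k]} (-1)^{|S|} bias_S(x)`.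
[Allen–O'Donnell–Witmer 2015, §4.1 (proof of Cor. 4.2) and §4.3 (Proof 2 of Thm. 4.9), for
`P = OR_k`; O'Donnell 2014, §1.2] [cite: arXiv150504383, §4.3] -/
theorem two_pow_mul_falsifiedCount_eq_sum_bias (L : List (AOWConstraint k n)) (x : Fin n → Bool) :
    (2 : ℤ) ^ k * falsifiedCount L x = ∑ S : Finset (Fin k), (-1) ^ S.card * bias L S x := by
  induction L with
  | nil => simp
  | cons C L ih =>
    have hC : (2 : ℤ) ^ k * (if C.IsFalsifiedBy x then 1 else 0) =
        ∑ S : Finset (Fin k), (-1) ^ S.card * ∏ i ∈ S, C.litSign x i := by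
      rw [← prod_one_sub_eq_sum_powerset, AOWConstraint.prod_one_sub_litSign]
      split_ifs <;> simp
    rw [falsifiedCount_cons, Nat.cast_add, mul_add, ih]
    simp only [bias_cons, mul_add, Finset.sum_add_distrib]
    rw [← hC, add_comm]
    split_ifs <;> simp

/-- If `x` falsifies no constraint of `L` then `|L| ≤ ∑_{S ≠ ∅} |bias_S(x)|`.
[Allen–O'Donnell–Witmer 2015, §4.3 (Proof 2 of Thm. 4.9)] [cite: arXiv150504383, §4.3] -/
theorem length_le_sum_abs_bias (L : List (AOWConstraint k n)) (x : Fin n → Bool)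
    (h : ∀ C ∈ L, ¬ C.IsFalsifiedBy x) :
    (L.length : ℤ) ≤ ∑ S ∈ (univ : Finset (Finset (Fin k))).erase ∅, |bias L S x| := by
  have h0 : falsifiedCount L x = 0 := (falsifiedCount_eq_zero_iff L x).2 h
  have h1 := two_pow_mul_falsifiedCount_eq_sum_bias L x
  rw [h0, Nat.cast_zero, mul_zero, ← Finset.add_sum_erase _ _ (Finset.mem_univ ∅)] at h1
  simp only [Finset.card_empty, pow_zero, one_mul, bias_empty] at h1
  have h2 : (L.length : ℤ) = ∑ S ∈ (univ : Finset (Finset (Fin k))).erase ∅,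
      -((-1) ^ S.card * bias L S x) := by
    rw [Finset.sum_neg_distrib]
    linarith
  rw [h2]
  refine Finset.sum_le_sum fun S _ => ?_
  calc -((-1) ^ S.card * bias L S x) ≤ |(-1) ^ S.card * bias L S x| := neg_le_abs _
    _ = |bias L S x| := by rw [abs_mul, abs_pow, abs_neg, abs_one, one_pow, one_mul]

/-- **Refutation criterion.** If `∑_{S ≠ ∅} |bias_S(x)| < |L|` then `x` falsifies some constraint
of `L`. [Allen–O'Donnell–Witmer 2015, §4.3 (Proof 2 of Thm. 4.9), `P = OR_k`] [cite: arXiv150504383, §4.3] -/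
theorem exists_falsified_of_sum_abs_bias_lt (L : List (AOWConstraint k n)) (x : Fin n → Bool)
    (h : ∑ S ∈ (univ : Finset (Finset (Fin k))).erase ∅, |bias L S x| < L.length) :
    ∃ C ∈ L, C.IsFalsifiedBy x := by
  by_contra hc
  simp only [not_exists, not_and] at hc
  exact absurd h (not_lt.2 (length_le_sum_abs_bias L x hc))

/-- The uniform per-level form of the criterion: if `2^k · |bias_S(x)| < |L|` for every non-empty
`S`, then `x` falsifies some constraint (there are `2^k - 1` non-empty levels).
[Allen–O'Donnell–Witmer 2015, §4.3 (Proof 2 of Thm. 4.9: `|D̂(S)| ≤ γ/2^{2k}` for all `S`)] [cite: arXiv150504383, §4.3] -/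
theorem exists_falsified_of_forall_bias_lt (hk : 0 < k) (L : List (AOWConstraint k n))
    (x : Fin n → Bool)
    (h : ∀ S : Finset (Fin k), S ≠ ∅ → (2 : ℤ) ^ k * |bias L S x| < L.length) :
    ∃ C ∈ L, C.IsFalsifiedBy x := by
  apply exists_falsified_of_sum_abs_bias_lt
  set E := (univ : Finset (Finset (Fin k))).erase ∅ with hE
  have hcard : (E.card : ℤ) = 2 ^ k - 1 := by
    rw [hE, Finset.card_erase_of_mem (Finset.mem_univ _), Finset.card_univ, Fintype.card_finset,
      Fintype.card_fin, Nat.cast_sub Nat.one_le_two_pow]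
    simp
  have hne : E.Nonempty := ⟨univ, by
    rw [hE, Finset.mem_erase]
    exact ⟨(Finset.univ_nonempty_iff.2 ⟨⟨0, hk⟩⟩).ne_empty, Finset.mem_univ _⟩⟩
  have hlt : ∀ S ∈ E, (2 : ℤ) ^ k * |bias L S x| < L.length := fun S hS =>
    h S (Finset.ne_of_mem_erase hS)
  have hsum : (2 : ℤ) ^ k * ∑ S ∈ E, |bias L S x| < E.card * L.length := by
    rw [Finset.mul_sum]
    calc ∑ S ∈ E, (2 : ℤ) ^ k * |bias L S x| < ∑ S ∈ E, (L.length : ℤ) :=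
          Finset.sum_lt_sum_of_nonempty hne hlt
      _ = E.card * L.length := by rw [Finset.sum_const, nsmul_eq_mul]
  rw [hcard] at hsum
  have hL : (0 : ℤ) ≤ L.length := Nat.cast_nonneg _
  have hS0 : 0 ≤ ∑ S ∈ E, |bias L S x| := Finset.sum_nonneg fun S _ => abs_nonneg _
  have h2k : (1 : ℤ) ≤ 2 ^ k := one_le_pow₀ (by norm_num)
  by_contra hge
  rw [not_lt] at hge
  nlinarith

/-! ### Link to the tree's CNF semantics -/

/-- The clause of `C` is false under `σ : ℕ → Bool` iff `C` is falsified by the restriction of `σ`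
to `Fin n`. [Allen–O'Donnell–Witmer 2015, Def. 3.1 (`P(c ∘ x_S)` with `P = OR_k`)] [folklore] -/
theorem AOWConstraint.eval_toClause_eq_false_iff (C : AOWConstraint k n) (σ : ℕ → Bool) :
    Clause.eval σ C.toClause = false ↔ C.IsFalsifiedBy fun v => σ v := by
  rw [AOWConstraint.IsFalsifiedBy]
  simp only [Clause.eval, AOWConstraint.toClause, List.any_eq_false, List.mem_ofFn,
    Literal.eval, forall_exists_index]
  constructor
  · intro h i
    have := h _ i rfl
    simpa using this
  · rintro h l i rfl
    simpa using h i

/-- **Soundness of the Fourier criterion for CNFs.** If every clause of `L` occurs in `φ` and, for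
every assignment, `∑_{S ≠ ∅} |bias_S(x)| < |L|`, then `φ` is unsatisfiable (refuting a
sub-multiset of clauses refutes the formula). [Allen–O'Donnell–Witmer 2015, §4.3 (Proof 2 of
Thm. 4.9), `P = OR_k`] [cite: arXiv150504383, §4.3] -/
theorem not_satisfiable_of_forall_exists_falsified (L : List (AOWConstraint k n)) {φ : CNF ℕ}
    (hsub : ∀ C ∈ L, C.toClause ∈ φ)
    (h : ∀ x : Fin n → Bool, ∃ C ∈ L, C.IsFalsifiedBy x) : ¬ φ.Satisfiable := by
  rintro ⟨σ, hσ⟩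
  obtain ⟨C, hC, hf⟩ := h fun v => σ v
  have h1 := (CNF.eval_eq_true_iff φ σ).1 hσ _ (hsub C hC)
  rw [(AOWConstraint.eval_toClause_eq_false_iff C σ).2 hf] at h1
  exact Bool.false_ne_true h1

/-- The criterion in bias form. [Allen–O'Donnell–Witmer 2015, §4.3] [cite: arXiv150504383, §4.3] -/
theorem not_satisfiable_of_sum_abs_bias_lt (L : List (AOWConstraint k n)) {φ : CNF ℕ}
    (hsub : ∀ C ∈ L, C.toClause ∈ φ)
    (h : ∀ x : Fin n → Bool,
      ∑ S ∈ (univ : Finset (Finset (Fin k))).erase ∅, |bias L S x| < L.length) :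
    ¬ φ.Satisfiable :=
  not_satisfiable_of_forall_exists_falsified L hsub fun x =>
    exists_falsified_of_sum_abs_bias_lt L x (h x)

end Literature.Computability.Complexity
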